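import Mathlib
import Literature.Computability.AlgebraicComplexity.LandsbergRessayreNormalForm
import Literature.Computability.AlgebraicComplexity.OrbitClosureEuclidean
import Summits.ValiantsHypothesis.ValiantsHypothesis.Theorems.RefutationDegreeBeyondHessianNsStubIdentityTransfer

/-!
# Zariski closure ⊂ classical closure for the jet variety (crux `BeyondHessianNs`)

Helper file for crux item stmt-ValiantsHypothesis-5641 (`RefutationDegree.BeyondHessianNs`),
stub `stub_zariskiDense` (step S2) of the line `Sketch`.

Let `m = ⌊n²/2⌋ + 1`, `Λ₀ = lamMatrix ℂ 0 = diag(0, 1, …, 1)` of size `m`, and let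
`𝒮_n = {(coeff_μ det(Λ₀ + Σ_e X_e Z_e))_μ : Z ∈ (ℂ^{m×m})^{n×n}}` be the jet variety, a subset
of the coefficient space `(Fin n × Fin n →₀ ℕ) → ℂ`.  Claim (`stub_zariskiDense`): if `p` is a
common zero of every polynomial (in finitely many coefficient coordinates) vanishing on `𝒮_n`,
then for every finite set `F` of exponents the restriction `p|_F` lies in the closure, for the
classical (product) topology of `F → ℂ`, of the set of restrictions to `F` of the points of `𝒮_n`.

Proof.  The restricted jet map `Z ↦ (coeff_μ det(Λ₀ + Σ_e X_e Z_e))_{μ ∈ F}` is a polynomial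
map `ℂ^ι → ℂ^F`, `ι = (Fin n × Fin n) × (Fin m × Fin m)`: its components are the complex
evaluations of `P_μ = coeff_μ det(Λ₀ + Σ_e X_e 𝒵_e) ∈ ℂ[z_ι]` for the generic matrices
`𝒵_e = (z_{e,i,j})_{i,j}` (naturality of the pencil in the coefficient ring,
`coeff_det_normalFormPencil`).  By
`Literature.Computability.AlgebraicComplexity.mem_closure_range_of_ker_bind₁_le` (Chevalley's
theorem + the density theorem SGA1 XII 2.2: the Zariski closure of the image of a complex
polynomial map lies in its classical closure) it suffices that every `Ψ ∈ ℂ[y_F]` with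
`Ψ(P) = 0` vanishes at `p|_F`.  But `Ψ(P) = 0` says that `rename (↑) Ψ`, a polynomial in the
coefficient coordinates, vanishes on `𝒮_n` (`aeval_rename`, `aeval_bind₁`); hence it vanishes at
`p`, i.e. `Ψ(p|_F) = 0`.
-/

noncomputable section

-- single-conjunct layout: Sub = Summit, duplicated namespace component intended
set_option linter.dupNamespace false

namespace Summit.ValiantsHypothesis.ValiantsHypothesis.Theorems.RefutationDegreeBeyondHessianNs

open MvPolynomial Matrix
open Literature.Computability.AlgebraicComplexity

/-- The determinant of the pencil `Λ₀ + Σ_e X_e Z_e` with constant part `Λ₀ = diag(0,1,…,1)` of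
size `⌊n²/2⌋ + 1` (local notation of the line `Sketch`). -/
local notation3 (prettyPrint := false) "pencilDet[" n ", " Z "]" =>
  (((Literature.Computability.AlgebraicComplexity.lamMatrix ℂ (0 : Fin (n ^ 2 / 2 + 1))).map MvPolynomial.C +
      ∑ e : Fin n × Fin n, (MvPolynomial.X e : MvPolynomial (Fin n × Fin n) ℂ) •
        (Z e).map (MvPolynomial.C : ℂ →+* MvPolynomial (Fin n × Fin n) ℂ) :
      Matrix (Fin (n ^ 2 / 2 + 1)) (Fin (n ^ 2 / 2 + 1)) (MvPolynomial (Fin n × Fin n) ℂ)).det)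

/-- The jet variety of the line at size `m = ⌊n²/2⌋ + 1`: coefficient vectors of
`det(Λ₀ + Σ_e x_e Z_e)`, `Z ∈ (ℂ^{m×m})^{n×n}` (local notation of the line `Sketch`). -/
local notation3 (prettyPrint := false) "jetVariety[" n "]" =>
  Set.range (fun Z : Fin n × Fin n → Matrix (Fin (n ^ 2 / 2 + 1)) (Fin (n ^ 2 / 2 + 1)) ℂ =>
    fun μ : Fin n × Fin n →₀ ℕ => MvPolynomial.coeff μ
      (((Literature.Computability.AlgebraicComplexity.lamMatrix ℂ (0 : Fin (n ^ 2 / 2 + 1))).map MvPolynomial.C +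
        ∑ e : Fin n × Fin n, (MvPolynomial.X e : MvPolynomial (Fin n × Fin n) ℂ) •
          (Z e).map (MvPolynomial.C : ℂ →+* MvPolynomial (Fin n × Fin n) ℂ) :
          Matrix (Fin (n ^ 2 / 2 + 1)) (Fin (n ^ 2 / 2 + 1)) (MvPolynomial (Fin n × Fin n) ℂ)).det))

/-- The ring of the generic point: `ℂ[z_{e,i,j}]`, `e : Fin n × Fin n`, `i j : Fin (⌊n²/2⌋ + 1)`
(local notation). -/
local notation3 "𝕊[" n "]" =>
  MvPolynomial ((Fin n × Fin n) × (Fin (n ^ 2 / 2 + 1) × Fin (n ^ 2 / 2 + 1))) ℂ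

/-- **The registered stub `stub_zariskiDense`** (line `Sketch`, crux `BeyondHessianNs`; step S2,
Zariski closure ⊂ classical closure for the jet variety, on any finite set `F` of exponents): if
`p` is a common zero of all polynomials (in the coefficient coordinates) vanishing on the jet
variety `{coeff det(Λ₀ + Σ_e X_e Z_e)}`, then the restriction of `p` to `F` is a limit, for the
classical topology of `F → ℂ`, of restrictions of jets.  The restricted jet map is polynomial in
the entries of `Z` (generic matrices, `coeff_det_normalFormPencil`), so
`Literature.Computability.AlgebraicComplexity.mem_closure_range_of_ker_bind₁_le` applies: a
polynomial relation `Ψ(P) = 0` among its components gives `rename (↑) Ψ ∈ vanishingIdeal` of the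
jet variety, hence `Ψ(p|_F) = 0` (module docstring). [cite: LandsbergGCT2017, Thm 3.1.6.1] -/
theorem stub_zariskiDense : ∀ (n : ℕ) (F : Finset (Fin n × Fin n →₀ ℕ)) (p : (Fin n × Fin n →₀ ℕ) → ℂ), p ∈ MvPolynomial.zeroLocus ℂ (MvPolynomial.vanishingIdeal ℂ (jetVariety[n])) → (fun μ : ↥F => p μ.1) ∈ closure (Set.range fun Z : Fin n × Fin n → Matrix (Fin (n ^ 2 / 2 + 1)) (Fin (n ^ 2 / 2 + 1)) ℂ => fun μ : ↥F => MvPolynomial.coeff μ.1 (pencilDet[n, Z])) := by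
  intro n F p hp
  classical
  -- (a)+(b) the generic pencil determinant `G` over `ℂ[z_{e,i,j}]` specialises, along every
  -- complex point `z` of the entries, to the pencil determinant of the matrices `Z = 𝒵(z)`
  obtain ⟨G, hG⟩ : ∃ G : MvPolynomial (Fin n × Fin n) 𝕊[n],
      ∀ (z : (Fin n × Fin n) × (Fin (n ^ 2 / 2 + 1) × Fin (n ^ 2 / 2 + 1)) → ℂ)
        (Z : Fin n × Fin n → Matrix (Fin (n ^ 2 / 2 + 1)) (Fin (n ^ 2 / 2 + 1)) ℂ),
        (∀ e i j, z (e, (i, j)) = Z e i j) → ∀ μ : Fin n × Fin n →₀ ℕ,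
          MvPolynomial.coeff μ (pencilDet[n, Z]) = MvPolynomial.eval z (MvPolynomial.coeff μ G) :=
    ⟨((lamMatrix 𝕊[n] (0 : Fin (n ^ 2 / 2 + 1))).map MvPolynomial.C +
        ∑ e : Fin n × Fin n, (MvPolynomial.X e : MvPolynomial (Fin n × Fin n) 𝕊[n]) •
          (Matrix.of fun i j => (MvPolynomial.X (e, (i, j)) : 𝕊[n])).map
            (MvPolynomial.C : 𝕊[n] →+* MvPolynomial (Fin n × Fin n) 𝕊[n]) :
        Matrix (Fin (n ^ 2 / 2 + 1)) (Fin (n ^ 2 / 2 + 1)) (MvPolynomial (Fin n × Fin n) 𝕊[n])).det,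
      fun z Z hzZ μ => coeff_det_normalFormPencil (MvPolynomial.eval z) (0 : Fin (n ^ 2 / 2 + 1))
        (Z₁ := fun e => Matrix.of fun i j => (MvPolynomial.X (e, (i, j)) : 𝕊[n])) (Z₂ := Z)
        (fun e i j => (MvPolynomial.eval_X _).trans (hzZ e i j)) μ⟩
  -- the polynomial map `ℂ^ι → ℂ^F` in the finitely many coordinates `F`
  set P : ↥F → 𝕊[n] := fun μ => MvPolynomial.coeff μ.1 G with hP
  have hPZ : ∀ (z : (Fin n × Fin n) × (Fin (n ^ 2 / 2 + 1) × Fin (n ^ 2 / 2 + 1)) → ℂ)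
      (Z : Fin n × Fin n → Matrix (Fin (n ^ 2 / 2 + 1)) (Fin (n ^ 2 / 2 + 1)) ℂ),
      (∀ e i j, z (e, (i, j)) = Z e i j) →
      (fun t : ↥F => MvPolynomial.aeval z (P t)) =
        fun t : ↥F => MvPolynomial.coeff t.1 (pencilDet[n, Z]) := by
    intro z Z hzZ
    funext t
    rw [MvPolynomial.aeval_eq_eval]
    exact (hG z Z hzZ t.1).symm
  -- (c)+(d) Zariski closure ⊂ classical closure for the image of `P`, whose points are jets
  have hcl := mem_closure_range_of_ker_bind₁_le P (z := fun μ : ↥F => p μ.1) ?_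
  · refine closure_mono ?_ hcl
    rintro _ ⟨x, rfl⟩
    exact ⟨fun e => Matrix.of fun i j => x (e, (i, j)), (hPZ x _ fun _ _ _ => rfl).symm⟩
  · -- a polynomial relation among the `P_μ` is an equation of the jet variety
    intro Ψ hΨ
    rw [RingHom.mem_ker] at hΨ ⊢
    have hmem : MvPolynomial.rename ((↑) : ↥F → (Fin n × Fin n →₀ ℕ)) Ψ ∈
        MvPolynomial.vanishingIdeal ℂ (jetVariety[n]) := by
      rw [MvPolynomial.mem_vanishingIdeal_iff, Set.forall_mem_range]
      intro Z
      rw [MvPolynomial.aeval_rename, Function.comp_def,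
        ← hPZ (fun v => Z v.1 v.2.1 v.2.2) Z fun _ _ _ => rfl,
        ← MvPolynomial.aeval_bind₁ (fun v => Z v.1 v.2.1 v.2.2) P Ψ, hΨ, map_zero]
    rw [MvPolynomial.mem_zeroLocus_iff] at hp
    have h := hp _ hmem
    rwa [MvPolynomial.aeval_rename] at h

end Summit.ValiantsHypothesis.ValiantsHypothesis.Theorems.RefutationDegreeBeyondHessianNs

end
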